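import Literature.Geometry.Kaehler.ComplexTorusPolarizationSubtoriSumInequality
import Literature.Geometry.Kaehler.ComplexTorusIsogenies
import HarnessLib

/-!
# Debarre 1996, Corollaire 4 for `r` abelian subvarieties: `(Y₁ ⋯ Y_r) · h⁰(X, L) ≤ ∏ h⁰(Y_k, L|Y_k)`,
# `Y₁ ⋯ Y_r = deg(μ : ∏ Y_k → X)`

Layer `Literature/Geometry/Kaehler`, namespace `Literature.Geometry.Kaehler.ComplexTorus`; lane `lit-hodgefound`
(Track 2 foundations library), seat p16, generation 15, row g15-#1 FILE 3 (rider of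
`ComplexTorusPolarizationSubtoriSumInequality`). THEOREMS ONLY: no definition, no named fact, net debt `0`.

## Source, VERBATIM

O. Debarre, *Polarisations sur les variétés abéliennes produits*, C. R. Acad. Sci. Paris Sér. I **323** (1996)
631–635 [Debarre1996PolarisationsProduits], p. 634: «Si `X₁` et `X₂` sont des sous-variétés abéliennes d'une variété
abélienne `X`, on définit `X₁·X₂` comme le degré de l'application `X₁ × X₂ → X` qui à `(x₁, x₂)` associe `x₁ − x₂`.
[…] **Corollaire 4.** Soient `X` une variété abélienne, et `X₁` et `X₂` des sous-variétés abéliennes de `X`. Si `L`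
est un fibré en droites ample sur `X`, on a `(X₁·X₂) h⁰(X, L) ≤ h⁰(X₁, L|X₁) h⁰(X₂, L|X₂)`. On peut supposer
`d = X₁·X₂` non nul, de sorte que l'application `π : X₁ × X₂ → X` est une isogénie de degré `d`. Le théorème donne
`h⁰(X₁ × X₂, π*L) ≤ h⁰(X₁, L|X₁) h⁰(X₂, L|X₂)`. Ceci montre le corollaire puisque `h⁰(X₁ × X₂, π*L) = d h⁰(X, L)`.»

## What this rider adds — the same deduction for `r` abelian subvarieties (the note prints `r = 2`)

For complex lattice subspaces `V_k` (`k : κ` finite) with `Λ ⊗ ℝ = ⊕_k V_k` (`DirectSum.IsInternal V`: abelian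
subvarieties `Y_{V_k}` whose addition map `μ : ∏_k Y_{V_k} → X` — p10's `mapMatrix … (sumMatrix V)` with analytic
representation `sumRep` — is an isogeny, `isIsogeny_sum_of_isInternal`), the degree identity
**«`h⁰(∏ Y_k, μ*L) = d h⁰(X, L)`», `d = deg μ = #ker μ`, squared**: `polarizationDegree (∏ Y_k, μ^*η) =
(#ker μ)² · polarizationDegree (X, η)` (**`polarizationDegree_pullbackForm_sumRep`**, via Lange Prop. 1.1.13:
`deg μ = |det P□|` for the square reindexing `P□` of the rational representation `P = sumMatrix V`, the tree's
`natCard_ker_mapMatrixHom_eq_natAbs_det_submatrix`), and with FILE 2's `debarre1996_theoreme_3_sum`: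
**`debarre1996_corollaire_4_sum`**: `(#ker μ)² · polarizationDegree (X, η) ≤ ∏_k polarizationDegree (Y_k, η|Y_k)`, equality
iff the `Y_{V_k}` are pairwise `η`-orthogonal, and VERBATIM for `h⁰`: **`debarre1996_corollaire_4_sum_h0`**
(`#ker μ · h⁰(X, L) ≤ ∏_k h⁰(Y_k, L|Y_k)`). The case `r = 2` (`X₁·X₂ = #(X₁ ∩ X₂)`, carrier `prodPeriod`) is
`ComplexTorusPolarizationAdditionDegree` / `…ProductInequalityH0` (row g14-#3), not restated.
-- TODO(general form): the trivial case «`d = X₁·X₂` nul» (sub-varieties NOT spanning, or with positive-dimensional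
-- intersection: `μ` not an isogeny, degree `0` by Debarre's convention) is not given a statement.

## References

* [Debarre1996PolarisationsProduits] O. Debarre, C. R. Acad. Sci. Paris Sér. I **323** (1996) 631–635, § 2 Corollaire 4
  and its proof (author's PDF `debarre-pub/33.pdf` pp. 3–4).
* [Lange2023AbelianVarietiesComplex] H. Lange, *Abelian Varieties over the Complex Numbers*, Springer 2023, §1.1.2
  Prop. 1.1.13 (`deg ρ(A) = |det A|`), §2.4.4 Thm. 2.4.25 (the addition map of a direct-sum family), §1.5.3 Thm. 1.5.9.
-/

noncomputable section

open Module Function Complex Matrix Finset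

namespace Literature.Geometry.Kaehler

namespace ComplexTorus

section Degree

variable {ι : Type*} [Fintype ι] [DecidableEq ι] {E : Type*} [NormedAddCommGroup E] [NormedSpace ℂ E]
  (Φ : (ι → ℝ) ≃L[ℝ] E) {κ : Type*} [Fintype κ] [DecidableEq κ] (V : κ → Submodule ℝ (ι → ℝ))
  {η : E [⋀^Fin 2]→L[ℝ] ℝ}

/-- **The Gram matrix of `μ^*η` on `⊕_k Λ_k` is `ᵗP G P`**, `P = sumMatrix V` the rational representation of the
addition map `μ`. [cite: Debarre1996PolarisationsProduits, proof of Corollaire 4 («`h⁰(X₁ × X₂, π*L)`»)]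
[cite: Lange2023AbelianVarietiesComplex, §1.4.2 Prop. 1.4.6 (d) and §2.4.4 Thm. 2.4.25] -/
theorem latticeGram_pullbackForm_sumRep (hV : ∀ k, IsLatticeSubspace (V k)) (hVc : ∀ k, IsComplexSubspace Φ (V k))
    (η : E [⋀^Fin 2]→L[ℝ] ℝ) :
    latticeGram (sigmaPiPeriod fun k ↦ subtorusPeriod Φ (V k) (hV k) (hVc k)) (pullbackForm (sumRep Φ V) η) =
      ((sumMatrix V).map (Int.cast : ℤ → ℝ))ᵀ * latticeGram Φ η * (sumMatrix V).map (Int.cast : ℤ → ℝ) :=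
  latticeGram_pullbackForm_of_real Φ _ (sumRep Φ V) (sumRep_sigmaPiPeriod Φ hV hVc) η

omit [Fintype ι] [DecidableEq ι] [Fintype κ] [DecidableEq κ] in
/-- An integer matrix and its real form have the same determinant. [folklore] -/
private theorem det_map_intCast' {m : Type*} [Fintype m] [DecidableEq m] (B : Matrix m m ℤ) :
    (B.map (Int.cast : ℤ → ℝ)).det = (B.det : ℝ) := by
  rw [show B.map (Int.cast : ℤ → ℝ) = (Int.castRingHom ℝ).mapMatrix B from rfl, ← RingHom.map_det, eq_intCast]

/-- **`det E' = det(P□)² · det E`** for the Gram matrix `E' = ᵗP E P` of `μ^*η` on `⊕_k Λ_k` and the square reindexing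
`P□ = P.submatrix σ id` of `P = sumMatrix V` along any bijection `σ : (Σ_k Fin rk Λ_k) ≃ ι`.
[cite: Lange2023AbelianVarietiesComplex, §1.1.2 Prop. 1.1.13 (proof of (c)), p. 22] [cite: Debarre1996PolarisationsProduits, proof of Corollaire 4] -/
theorem det_latticeGram_pullbackForm_sumRep (hV : ∀ k, IsLatticeSubspace (V k))
    (hVc : ∀ k, IsComplexSubspace Φ (V k)) (σ : (Σ k, Fin (subRank (V k))) ≃ ι) :
    (latticeGram (sigmaPiPeriod fun k ↦ subtorusPeriod Φ (V k) (hV k) (hVc k)) (pullbackForm (sumRep Φ V) η)).det =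
      (((sumMatrix V).submatrix σ id).det : ℝ) ^ 2 * (latticeGram Φ η).det := by
  set P := (sumMatrix V).map (Int.cast : ℤ → ℝ) with hP
  set G := latticeGram Φ η with hG
  have hB : ((sumMatrix V).submatrix σ id).map (Int.cast : ℤ → ℝ) = P.submatrix σ id := by
    rw [hP, submatrix_map]
  have h : (P.submatrix σ id)ᵀ * G.submatrix σ σ * P.submatrix σ id = Pᵀ * G * P := by
    rw [transpose_submatrix, submatrix_mul_equiv, submatrix_mul_equiv, submatrix_id_id]
  rw [latticeGram_pullbackForm_sumRep Φ V hV hVc, ← hP, ← hG, ← h, det_mul, det_mul, det_transpose,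
    det_submatrix_equiv_self, ← hB, det_map_intCast']
  ring

omit [DecidableEq ι] in
/-- **`Σ_k rk Λ_k = rk Λ`** for an internal direct sum `Λ ⊗ ℝ = ⊕_k V_k` of lattice subspaces («`dim Y + dim Z = dim X`»
for `r` summands): the lattice index `Σ_k Fin (rk Λ_k)` of `∏_k Y_{V_k}` has the cardinality of `ι`.
[cite: Lange2023AbelianVarietiesComplex, §2.4.4 Cor. 2.4.24 and Thm. 2.4.25, p. 123] -/
theorem card_sigma_fin_subRank_eq (hV : ∀ k, IsLatticeSubspace (V k)) (h : DirectSum.IsInternal V) :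
    Fintype.card (Σ k, Fin (subRank (V k))) = Fintype.card ι := by
  let b : ∀ k, Basis (Fin (subRank (V k))) ℝ (V k) := fun k ↦
    Module.finBasisOfFinrankEq ℝ (V k) (finrank_eq_subRank (hV k))
  have hcard := Module.finrank_eq_card_basis (h.collectedBasis b)
  rw [Module.finrank_fintype_fun_eq_card] at hcard
  exact hcard.symm

/-- **«`h⁰(X₁ × X₂, π*L) = d h⁰(X, L)`», for `r` abelian subvarieties, squared: `polarizationDegree (∏ Y_k, μ^*η) =
(#ker μ)² · polarizationDegree (X, η)`** for `Λ ⊗ ℝ = ⊕_k V_k`, `μ` the addition isogeny `∏_k Y_{V_k} → X`.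
[cite: Debarre1996PolarisationsProduits, proof of Corollaire 4] [cite: Lange2023AbelianVarietiesComplex, §1.1.2 Prop. 1.1.13 and §2.4.4 Thm. 2.4.25] -/
theorem polarizationDegree_pullbackForm_sumRep (hV : ∀ k, IsLatticeSubspace (V k))
    (hVc : ∀ k, IsComplexSubspace Φ (V k)) (h : DirectSum.IsInternal V) :
    polarizationDegree (sigmaPiPeriod fun k ↦ subtorusPeriod Φ (V k) (hV k) (hVc k)) (pullbackForm (sumRep Φ V) η) =
      (Nat.card (mapMatrixHom (sigmaPiPeriod fun k ↦ subtorusPeriod Φ (V k) (hV k) (hVc k)) Φ (sumMatrix V)).ker : ℝ) ^ 2 *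
        polarizationDegree Φ η := by
  obtain ⟨σ⟩ : Nonempty ((Σ k, Fin (subRank (V k))) ≃ ι) := Fintype.card_eq.1 (card_sigma_fin_subRank_eq V hV h)
  rw [polarizationDegree_eq_det, polarizationDegree_eq_det, det_latticeGram_pullbackForm_sumRep Φ V hV hVc σ,
    natCard_ker_mapMatrixHom_eq_natAbs_det_submatrix _ Φ (sumMatrix V) σ, Nat.cast_natAbs, Int.cast_abs, sq_abs]

variable {Φ V}

/-- **Debarre 1996, Corollaire 4 for `r` abelian subvarieties, squared: `(Y₁ ⋯ Y_r)² · polarizationDegree (X, η) ≤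
∏_k polarizationDegree (Y_k, η|Y_k)`**, `Y₁ ⋯ Y_r = deg μ = #ker μ` the degree of the addition isogeny (for
`Λ ⊗ ℝ = ⊕_k V_k`) — «`(X₁·X₂) h⁰(X, L) ≤ h⁰(X₁, L|X₁) h⁰(X₂, L|X₂)`» for `r` sub-varieties, from FILE 2's Théorème 3 along
`μ` and the degree identity. [cite: Debarre1996PolarisationsProduits, Corollaire 4] [cite: HornJohnson2013, §7.8 (7.8.7)] -/
theorem debarre1996_corollaire_4_sum (hη : IsRiemannForm Φ η) (hV : ∀ k, IsLatticeSubspace (V k))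
    (hVc : ∀ k, IsComplexSubspace Φ (V k)) (h : DirectSum.IsInternal V) :
    (Nat.card (mapMatrixHom (sigmaPiPeriod fun k ↦ subtorusPeriod Φ (V k) (hV k) (hVc k)) Φ (sumMatrix V)).ker : ℝ) ^ 2 *
        polarizationDegree Φ η ≤
      ∏ k, polarizationDegree (subtorusPeriod Φ (V k) (hV k) (hVc k)) (pullbackForm (cxSpan Φ (V k)).subtypeL η) := by
  rw [← polarizationDegree_pullbackForm_sumRep Φ V hV hVc h]
  exact debarre1996_theoreme_3_sum hη hV hVc h.submodule_iSupIndep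

/-- **Corollaire 4 for `r` sub-varieties, the equality case**: iff the `Y_{V_k}` are pairwise `η`-orthogonal.
[cite: Debarre1996PolarisationsProduits, Théorème 3 and Corollaire 4] -/
theorem debarre1996_corollaire_4_sum_eq_iff (hη : IsRiemannForm Φ η) (hV : ∀ k, IsLatticeSubspace (V k))
    (hVc : ∀ k, IsComplexSubspace Φ (V k)) (h : DirectSum.IsInternal V) :
    (Nat.card (mapMatrixHom (sigmaPiPeriod fun k ↦ subtorusPeriod Φ (V k) (hV k) (hVc k)) Φ (sumMatrix V)).ker : ℝ) ^ 2 *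
        polarizationDegree Φ η =
      ∏ k, polarizationDegree (subtorusPeriod Φ (V k) (hV k) (hVc k)) (pullbackForm (cxSpan Φ (V k)).subtypeL η) ↔
      ∀ k l, k ≠ l → ∀ v ∈ V k, ∀ w ∈ V l, η ![Φ v, Φ w] = 0 := by
  rw [← polarizationDegree_pullbackForm_sumRep Φ V hV hVc h]
  exact debarre1996_theoreme_3_sum_eq_iff hη hV hVc h.submodule_iSupIndep

omit [Fintype ι] [DecidableEq ι] [Fintype κ] [DecidableEq κ] in
/-- `a² ≤ b²` in `ℝ` for naturals gives `a ≤ b`. [folklore] -/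
private theorem natCast_le_of_sq_le₅ {a b : ℕ} (h : (a : ℝ) ^ 2 ≤ (b : ℝ) ^ 2) : a ≤ b := by
  have := (pow_le_pow_iff_left₀ (Nat.cast_nonneg a) (Nat.cast_nonneg b) two_ne_zero).1 h
  exact_mod_cast this

omit [Fintype ι] [DecidableEq ι] [Fintype κ] [DecidableEq κ] in
/-- `a² = b²` in `ℝ` for naturals iff `a = b`. [folklore] -/
private theorem natCast_sq_eq_sq_iff₅ {a b : ℕ} : (a : ℝ) ^ 2 = (b : ℝ) ^ 2 ↔ a = b := by
  rw [pow_left_inj₀ (Nat.cast_nonneg a) (Nat.cast_nonneg b) two_ne_zero, Nat.cast_inj]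

/-- **Debarre 1996, Corollaire 4, VERBATIM for `h⁰` and `r` abelian subvarieties: «`(X₁·X₂) h⁰(X, L) ≤
h⁰(X₁, L|X₁) h⁰(X₂, L|X₂)`» with `X₁ ⋯ X_r := deg(μ : ∏ X_k → X) = #ker μ`** for `L = L(H, χ)` and
`L|Y_{V_k} = L(H|Y_{V_k}, χ_k)` (any semicharacters), `Λ ⊗ ℝ = ⊕_k V_k`.
[cite: Debarre1996PolarisationsProduits, Corollaire 4] [cite: Lange2023AbelianVarietiesComplex, §1.5.3 Thm. 1.5.9] -/
theorem debarre1996_corollaire_4_sum_h0 (hη : IsRiemannForm Φ η) (hV : ∀ k, IsLatticeSubspace (V k))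
    (hVc : ∀ k, IsComplexSubspace Φ (V k)) (h : DirectSum.IsInternal V) {χ : (ι → ℤ) → ℂ}
    (hχ : IsSemicharacter Φ η χ) {χk : ∀ k, (Fin (subRank (V k)) → ℤ) → ℂ}
    (hχk : ∀ k, IsSemicharacter (subtorusPeriod Φ (V k) (hV k) (hVc k)) (pullbackForm (cxSpan Φ (V k)).subtypeL η) (χk k)) :
    Nat.card (mapMatrixHom (sigmaPiPeriod fun k ↦ subtorusPeriod Φ (V k) (hV k) (hVc k)) Φ (sumMatrix V)).ker *
        (lineBundleAH hη.isNSForm hχ).h0 ≤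
      ∏ k, (lineBundleAH (isRiemannForm_restrict Φ hη (hV k) (hVc k)).isNSForm (hχk k)).h0 := by
  apply natCast_le_of_sq_le₅
  push_cast
  rw [mul_pow, ← prod_pow, hη.sq_h0_lineBundleAH_eq_polarizationDegree hχ,
    prod_congr rfl fun k _ ↦ (isRiemannForm_restrict Φ hη (hV k) (hVc k)).sq_h0_lineBundleAH_eq_polarizationDegree (hχk k)]
  exact debarre1996_corollaire_4_sum hη hV hVc h

/-- **Corollaire 4 for `h⁰` and `r` sub-varieties, the equality case**: `(Y₁ ⋯ Y_r) h⁰(X, L) = ∏ h⁰(Y_k, L|Y_k)` iff the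
`Y_{V_k}` are pairwise `Im H`-orthogonal. [cite: Debarre1996PolarisationsProduits, Théorème 3 and Corollaire 4] -/
theorem debarre1996_corollaire_4_sum_h0_eq_iff (hη : IsRiemannForm Φ η) (hV : ∀ k, IsLatticeSubspace (V k))
    (hVc : ∀ k, IsComplexSubspace Φ (V k)) (h : DirectSum.IsInternal V) {χ : (ι → ℤ) → ℂ}
    (hχ : IsSemicharacter Φ η χ) {χk : ∀ k, (Fin (subRank (V k)) → ℤ) → ℂ}
    (hχk : ∀ k, IsSemicharacter (subtorusPeriod Φ (V k) (hV k) (hVc k)) (pullbackForm (cxSpan Φ (V k)).subtypeL η) (χk k)) :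
    Nat.card (mapMatrixHom (sigmaPiPeriod fun k ↦ subtorusPeriod Φ (V k) (hV k) (hVc k)) Φ (sumMatrix V)).ker *
        (lineBundleAH hη.isNSForm hχ).h0 =
      ∏ k, (lineBundleAH (isRiemannForm_restrict Φ hη (hV k) (hVc k)).isNSForm (hχk k)).h0 ↔
      ∀ k l, k ≠ l → ∀ v ∈ V k, ∀ w ∈ V l, η ![Φ v, Φ w] = 0 := by
  rw [← debarre1996_corollaire_4_sum_eq_iff hη hV hVc h, ← natCast_sq_eq_sq_iff₅]
  push_cast
  rw [mul_pow, ← prod_pow, hη.sq_h0_lineBundleAH_eq_polarizationDegree hχ,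
    prod_congr rfl fun k _ ↦ (isRiemannForm_restrict Φ hη (hV k) (hVc k)).sq_h0_lineBundleAH_eq_polarizationDegree (hχk k)]

end Degree

end ComplexTorus

end Literature.Geometry.Kaehler

end
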